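import Literature.NumberTheory.Automorphic.AutomorphicGaloisConj
import Literature.NumberTheory.Automorphic.Sweep1BaseChangeProofs
import HarnessLib

/-!
# Cuspidal weak base-change lifts are `Gal(E/F)`-stable (Arthur–Clozel, Thm. 4.2 (a); proof)

Topic `NumberTheory/Automorphic`; namespace `Literature.Lang`. Sibling proof file of
`AutomorphicGaloisConj` (Galois conjugates `Π^σ`) and `Sweep1BaseChangeProofs` (existence and
uniqueness of the cuspidal weak lift for `ℓ ∤ n`), all theorems **proved**:

* `IsWeakBaseChangeLift.isGalStable`, `isGalStable_of_isWeakBaseChangeLift_cuspidal`: a *cuspidal*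
  weak base-change lift `Π` on `GL_n(𝔸_E)` of a cuspidal `π` on `GL_n(𝔸_F)` is stable under every
  `σ ∈ Aut(E/F)`: `U_σ(Π) = Π` (`IsGalStable` of `AutomorphicGaloisConj`; `U_σ(Π) ≅ Π ∘ σ⁻¹` is
  Arthur–Clozel's `Π^{σ⁻¹}`, so stability under all `σ` is their "`σ`-stable" for all `σ`) —
  Arthur–Clozel, Ch. 3, Thm. 4.2 (a), the clause "`σ`-stable", by their own argument "the
  uniqueness of `Π` is obvious by (2.4)" (p. 176): `U_σ(Π)` is again a cuspidal weak lift of `π`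
  (`IsWeakBaseChangeLift.galConj`) and the cuspidal
  weak lift is unique (`IsWeakBaseChangeLift.unique` of `UnramifiedHeckeLevel`), granted strong
  multiplicity one over `E` (`strong_multiplicity_one_gl`, named fact; Jacquet–Shalika (2.4) with
  multiplicity one); the Satake inputs are the proved `exists_hasSatakeParameterAt_cofinite_holds`.
* `existsUnique_isGalStable_cuspidal_weakLift_of_not_dvd`: for `E/F` Galois of prime degree
  `ℓ ∤ n` and `π` cuspidal, in any `L²_cusp(GL_n(𝔸_E) ⧸ A_G GL_n(E))` there is a unique cuspidal
  weak lift `Π`, and it is `Gal(E/F)`-stable — Thm. 4.2 (a) for `ℓ ∤ n` in full ("unique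
  `σ`-stable `Π` lifting `π`; `Π` is cuspidal"), from the named facts
  `ArthurClozel1989_exists_cuspidal_weakLift_or_dvd` (existence), `strong_multiplicity_one_gl`
  and `isAutomorphicMeasure_unique_smul` (`σ` acts on `L²(ν)`).

## References

* J. Arthur, L. Clozel, *Simple algebras, base change, and the advanced theory of the trace
  formula*, Ann. of Math. Stud. 120 (1989), Ch. 3, Thm. 4.2 (a) and its proof, §4 (p. 176).
  [ArthurClozelAMS120]
-/

noncomputable section

open IsDedekindDomain


namespace Literature.NumberTheory.Automorphic

open NumberField IsDedekindDomain MeasureTheory Filter AdelicGroupData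

section BaseChangeCuspidal

variable {n : ℕ} {F E : Type} [Field F] [NumberField F] [Field E] [NumberField E] [Algebra F E]
variable {μ : Measure (gl n F).automorphicQuotient} [(gl n F).IsAutomorphicMeasure μ]
  {ν : Measure (gl n E).automorphicQuotient} [(gl n E).IsAutomorphicMeasure ν]

/-- **A cuspidal weak base-change lift is `σ`-stable** (the "`σ`-stable" of Arthur–Clozel,
Ch. 3, Thm. 4.2 (a): `Π ≅ Π^σ`; here `U_σ(Π) = Π` in `L²_cusp`, `U_σ(Π) ≅ Π ∘ σ⁻¹` being their
`Π^{σ⁻¹}`). Proof: `U_σ(Π)` is again a cuspidal weak lift of `π` (`IsWeakBaseChangeLift.galConj`),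
and the cuspidal weak lift is
unique by strong multiplicity one ("obvious by (2.4)", op. cit. p. 176;
`IsWeakBaseChangeLift.unique`). Inputs: `strong_multiplicity_one_gl` over `E` (named fact,
Jacquet–Shalika (2.4) with multiplicity one) and that `π` has Satake parameters at one level
almost everywhere (automatic for cuspidal `π`). [cite: ArthurClozelAMS120, Ch. 3, Thm. 4.2 (a)] -/
theorem IsWeakBaseChangeLift.isGalStable
    (hSMO : strong_multiplicity_one_gl (n := n) (K := E) (μ := ν))
    {W : ContRepresentation.ClosedSubrep ((gl n F).rightRegular μ)} {𝔫 : Ideal (𝓞 F)}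
    (hW : ∀ᶠ v : HeightOneSpectrum (𝓞 F) in cofinite,
      ∃ (ϖ : (v.adicCompletion F)ˣ) (α : Multiset ℂ),
        HasSatakeParameterAt W (principalCongruenceLevel n F 𝔫) v ϖ α)
    {Q : CuspidalAutomorphicRepGL n E ν} (hQ : IsWeakBaseChangeLift W Q.1) (hν : IsGalInvariant F ν)
    (σ : E ≃ₐ[F] E) : Q.IsGalStable F hν σ :=
  IsWeakBaseChangeLift.unique hSMO exists_hasSatakeParameterAt_cofinite_holds hW (hQ.galConj hν σ) hQ

/-- **Cuspidal weak lifts of cuspidal representations are `Gal(E/F)`-stable** (Arthur–Clozel,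
Ch. 3, Thm. 4.2 (a), the clause "`σ`-stable"): for `π` cuspidal on `GL_n(𝔸_F)` and `Π` a
cuspidal weak base-change lift of `π` on `GL_n(𝔸_E)`, `U_σ(Π) = Π` for every `σ ∈ Aut(E/F)`,
granted strong multiplicity one over `E`. [cite: ArthurClozelAMS120, Ch. 3, Thm. 4.2 (a)] -/
theorem isGalStable_of_isWeakBaseChangeLift_cuspidal
    (hSMO : strong_multiplicity_one_gl (n := n) (K := E) (μ := ν))
    (P : CuspidalAutomorphicRepGL n F μ)
    {Q : CuspidalAutomorphicRepGL n E ν} (hQ : IsWeakBaseChangeLift P.1 Q.1) (hν : IsGalInvariant F ν)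
    (σ : E ≃ₐ[F] E) : Q.IsGalStable F hν σ := by
  obtain ⟨𝔫, -, h𝔫⟩ := exists_hasSatakeParameterAt_cofinite_holds (n := n) (K := F) (μ := μ) P
  exact hQ.isGalStable hSMO h𝔫 hν σ

/-- **Arthur–Clozel, Ch. 3, Thm. 4.2 (a), case `ℓ ∤ n`, with `σ`-stability and uniqueness.**
For `E/F` Galois of prime degree `ℓ ∤ n` and `π` cuspidal on `GL_n(𝔸_F)`: in any
`L²_cusp(GL_n(𝔸_E) ⧸ A_G GL_n(E), ν)` (`ν` automorphic), there is a unique cuspidal weak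
base-change lift `Π` of `π`, and `Π` is `σ`-stable for every `σ ∈ Gal(E/F)` — from the named
facts `ArthurClozel1989_exists_cuspidal_weakLift_or_dvd` (Thm. 4.2 (a)–(b): existence),
`strong_multiplicity_one_gl` over `E` (uniqueness, "by (2.4)") and
`isAutomorphicMeasure_unique_smul` (so that `σ` acts on `L²(ν)`); everything else proved.
[cite: ArthurClozelAMS120, Ch. 3, Thm. 4.2 (a)] -/
theorem existsUnique_isGalStable_cuspidal_weakLift_of_not_dvd
    (hAC : ArthurClozel1989_exists_cuspidal_weakLift_or_dvd (n := n) (F := F) (E := E))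
    (hSMO : ∀ (ν : Measure (gl n E).automorphicQuotient) [(gl n E).IsAutomorphicMeasure ν],
      strong_multiplicity_one_gl (n := n) (K := E) (μ := ν))
    (hU : isAutomorphicMeasure_unique_smul n E)
    [IsGalois F E] (hℓ : (Module.finrank F E).Prime) (hn : ¬ Module.finrank F E ∣ n)
    (μ : Measure (gl n F).automorphicQuotient) [(gl n F).IsAutomorphicMeasure μ]
    (P : CuspidalAutomorphicRepGL n F μ) :
    ∃ (ν : Measure (gl n E).automorphicQuotient) (_ : (gl n E).IsAutomorphicMeasure ν)
      (hν : IsGalInvariant F ν),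
      ∃! Q : CuspidalAutomorphicRepGL n E ν,
        IsWeakBaseChangeLift P.1 Q.1 ∧ ∀ σ : E ≃ₐ[F] E, Q.IsGalStable F hν σ := by
  obtain ⟨ν, hνA, Q, hQ, huniq⟩ := existsUnique_cuspidal_weakLift_of_not_dvd' hAC hSMO hℓ hn μ P
  haveI := hνA
  refine ⟨ν, hνA, isGalInvariant_of_unique F hU ν, Q, ⟨hQ, fun σ => ?_⟩, fun Q' hQ' => huniq Q' hQ'.1⟩
  exact isGalStable_of_isWeakBaseChangeLift_cuspidal (hSMO ν) P hQ _ σ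

end BaseChangeCuspidal

end Literature.NumberTheory.Automorphic
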